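/-
Origin: expansion seat `prover-pub-hodgecm-mc-sinst-1-g3-0`, handover #1215 2026-08-20T07:45Z md5 59e32c13a95b (424 l.) NEW additive drop-alone leaf after landed #1212 + #P43a; (C-LINE1) R1 S side: isLFContinuous_lineRepT, lineRepT_apply_one_left (lineRepT … η ν k (1,t) = lineRepD … η k (1,t)), archLineInputT (ArchLineInput transport D → T), isLFAction/isThetaArchContinuous_archSideOfT, thetaAdelicSideOfPT (predicate-guarded total twisted term) + read-backs + hLF/hT both branches, SInstance.SGPT/SGPT_eq_archSideOfT/hLF_PT/hT_PT, ART, SRT (generic guard; ν hν hνc as pin-input families) + hT_RT/hLF_RT, SROGT (OG guard) + hT_ROGT/hLF_ROGT; install AFTER #P43a and #1212 (both landed); drop alone on bounce; NAME LIST: HodgeCM.Model.ArchSideTerm.isLFContinuous_lineRepT · HodgeCM.Model.ArchSideTerm.lineRepT_apply_one_left · HodgeCM.Model.ArchSideTerm.isLFAction_archSideOfT · HodgeCM.Model.ArchSideTerm.isThetaArchContinuous_archSideOfT · HodgeCM.Model.ArchSideTerm.thetaAdelicSideOfPT_eq_archSideOfT · HodgeCM.Model.ArchSideTerm.isLFAction_thetaAdelicSideOfPT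 · HodgeCM.Model.ArchSideTerm.isThetaArchContinuous_thetaAdelicSideOfPT · HodgeCM.Model.SInstance.SGPT_eq_archSideOfT · HodgeCM.Model.SInstance.hLF_PT · HodgeCM.Model.SInstance.hT_PT · HodgeCM.Model.SInstance.hT_RT · HodgeCM.Model.SInstance.hLF_RT · HodgeCM.Model.SInstance.hT_ROGT · HodgeCM.Model.SInstance.hLF_ROGT (`HOME/mc/pub-hodgecm-mc-sinst-1-g3/stage/HodgeCM/Model/ThetaAdelicSideGuardedT.lean`, md5 59e32c13a95b, 424 lines);
landed by the second packager p2 gen 4 (p2-g4) in gate run 44 as `HodgeCM/Model/ThetaAdelicSideGuardedT.lean` (verbatim).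
-/
/-
Origin: speedrun cell pub-hodgecm, MODEL-CONSTRUCTION sub-cell, lineage mc-sinst-1 (S-instance constructor, BINDER-OWNERS row 5 `S` + row 13 `hT`; (C-LINE1) R1),
seat prover-pub-hodgecm-mc-sinst-1-g3-0 (gen 3), 2026-08-20.  Target in PKG: `HodgeCM/Model/ThetaAdelicSideGuardedT.lean`
(NEW additive drop-alone leaf; RUN 44 material; imports RUN-42 #1212 `Model/ThetaAdelicSideReadOff` + period-1's RUN-43 #P43a `Model/ArchSideOfTwist`).
KERNEL only: 0 records / `def … : Prop` / cites, 0 proof holes; intended closure {propext, Classical.choice, Quot.sound}.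
-/
import Summits.HodgeConjecture.HodgeCM.Model.ThetaAdelicSideReadOff
import Summits.HodgeConjecture.HodgeCM.Model.ArchSideOfTwist

/-!
# (C-LINE1) R1, S SIDE: the guarded S family over period-1's ν-TWISTED term `archSideOfT`

RULING SUPPLEMENT 4 (lead 1-g61, l.12719; model1 (ii′) l.12722): row 12's line-1 half closes AT THE S PIN once the pin carries a
unitary twist `ν : CMAdelic L (frameD V) →* ℂˣ` of `U(V)(𝔸)` on the η-split (`etaT₀ = ν⁻¹∘fst · eta₀`, `etaT₁ = ν∘fst · eta₁`;
period-1 `Model/ArchSideOfTwist`, #P43a).  This leaf is the S-family side, exactly parallel to #1209: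

* §1 `isLFContinuous_lineRepT`, `isLFAction_archSideOfT`, `isThetaArchContinuous_archSideOfT` — rows `hLF`/13 at the twisted term;
* §2 **`lineRepT_apply_one_left`**: `lineRepT … η ν k (1, t) = lineRepD … η k (1, t)` (`ν 1 = 1`), hence **`archLineInputT`**: every
  archimedean line input over `lineRepD … k` IS one over `lineRepT … k` (same `Φ_∞, x₀, w`; the (W-wt) identity only sees `ω(1, t_∞)`) —
  so theta-3's (F1)/(T) data and the (J-μ) read-off datum (#1208/#1211/#1212) transfer to the twisted pin VERBATIM;
* §3 `thetaAdelicSideOfPT V c G hG … η hη hηc ν hν hνc AG` — the predicate-guarded total term over `archSideOfT`, read-backs, rows `hLF`/13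
  hypothesis-free;
* §4 family level `SInstance.SGPT` (+ `SGPT_eq_archSideOfT`, `hLF_PT`, `hT_PT`) and the ASSEMBLED (J-μ-pin) twins of #1212:
  **`SInstance.SRT`** (generic guard; ν, hν, hνc as INPUT families) and **`SInstance.SROGT`** (OG guard, `orientBitι`), with `hT_RT`, `hT_ROGT`.
ν is taken as an INPUT here (three pin-input families, the `hη/hηc` shape); the `χOfType`-style CONSTRUCTION of ν at the line-1
integer table (model1 R1′) composes on top once carch-1's η₁-generic conditions fix that table — a separate leaf.
Nothing here is a claim of PerL/QW8; nothing is cited as a fact.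
-/

set_option autoImplicit false

noncomputable section

open scoped Matrix SchwartzMap
open NumberField NumberField.mixedEmbedding
open Literature.NumberTheory.Automorphic Literature.NumberTheory.Weil1964
open Literature.NumberTheory.GelbartRogawski1991.UnitaryDualPair
open HodgeCM.Adelic HodgeCM.PerL34
open Literature.Geometry.ComplexHyperbolic.BallModel (U21)

namespace HodgeCM.Model

namespace ArchSideTerm

/-! ## § 1 LF-continuity and row 13 at the twisted term -/

section LF

variable {L : CMField} {ι₁ : L →+* ℂ} (V : HermSpace3 L ι₁) (S : StubTree.SeesawDatum L)
variable
  (hGR : (cmSplittingDatum (L : Type) finProdFinEquiv (frameD V) (frameD_real V) (frameD_ne V) (dW S) (dW_real S)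
    (dW_ne S)).CompatibleSplitting)
  (hGR₀ : (cmSplittingDatum (L : Type) (e₁) (frameD V) (frameD_real V) (frameD_ne V) (lineVec (L : Type) (dW S 0))
    (fun _ => dW_real S 0) (fun _ => dW_ne S 0)).CompatibleSplitting)
  (hGR₁ : (cmSplittingDatum (L : Type) (e₁) (frameD V) (frameD_real V) (frameD_ne V) (lineVec (L : Type) (dW S 1))
    (fun _ => dW_real S 1) (fun _ => dW_ne S 1)).CompatibleSplitting)
  (hGR₂ : (cmSplittingDatum (L : Type) (e₁) (frameD V) (frameD_real V) (frameD_ne V) (lineVec (L : Type) (dW' S 0))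
    (fun _ => dW'_real S 0) (fun _ => dW'_ne S 0)).CompatibleSplitting)
  (hGR₃ : (cmSplittingDatum (L : Type) (e₁) (frameD V) (frameD_real V) (frameD_ne V) (lineVec (L : Type) (dW' S 1))
    (fun _ => dW'_real S 1) (fun _ => dW'_ne S 1)).CompatibleSplitting)
  (η : CMAdelic (L : Type) (frameD V) × CMAdelic (L : Type) (dW S) →* ℂˣ) (ν : CMAdelic (L : Type) (frameD V) →* ℂˣ)

/-- each twisted line representation acts by LF-continuous operators (LAYER B is generic in the four η's). -/
theorem isLFContinuous_lineRepT (k : Fin 4)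
    (g : ↥(regimeSubgroup L V.Hm) × ↥(NumberField.relNormOneIdeles (↥(maximalRealSubfield L)) L)) :
    IsLFContinuous (lineRepT V S hGR hGR₀ hGR₁ hGR₂ hGR₃ η ν k g) :=
  isLFContinuous_lineRepOf V S hGR hGR₀ hGR₁ hGR₂ hGR₃ _ _ _ _ k g

/-! ## § 2 the twist is invisible on `{1} × U(1)(𝔸)`: archimedean line inputs transfer -/

/-- **`lineRepT … η ν k (1, t) = lineRepD … η k (1, t)`**: on the `U(V)`-trivial slice the ν-twisted split IS the default split (`ν 1 = 1`). -/
theorem lineRepT_apply_one_left (k : Fin 4) (t : ↥(NumberField.relNormOneIdeles (↥(maximalRealSubfield L)) L)) :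
    lineRepT V S hGR hGR₀ hGR₁ hGR₂ hGR₃ η ν k (1, t) = lineRepD V S hGR hGR₀ hGR₁ hGR₂ hGR₃ η k (1, t) := by
  -- on pairs with trivial `U(V)`-component the two splits agree line by line
  have key : ∀ p : CMAdelic (L : Type) (frameD V) × ↥(Literature.NumberTheory.Automorphic.relNormOneIdeles (↥(maximalRealSubfield L)) L),
      p.1 = 1 →
      lineRep V S hGR hGR₀ hGR₁ hGR₂ hGR₃ (etaT₀ V S η ν) (etaT₁ V S η ν) (eta₂ V S η) (eta₃ V S η) k p =
        lineRep V S hGR hGR₀ hGR₁ hGR₂ hGR₃ (eta₀ V S η) (eta₁ V S η) (eta₂ V S η) (eta₃ V S η) k p := by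
    rintro ⟨v, u⟩ hv
    change v = 1 at hv
    subst hv
    fin_cases k
    · refine LinearMap.ext fun φ => ?_
      change cmLineRepFin₀ (L : Type) finProdFinEquiv e₁ (frameD V) (frameD_real V) (frameD_ne V) (dW S) (dW_real S) (dW_ne S) hGR hGR₀ hGR₁
          (etaT₀ V S η ν) (1, u) φ =
        cmLineRepFin₀ (L : Type) finProdFinEquiv e₁ (frameD V) (frameD_real V) (frameD_ne V) (dW S) (dW_real S) (dW_ne S) hGR hGR₀ hGR₁
          (eta₀ V S η) (1, u) φ
      rw [cmLineRepFin₀_apply_eq_smul_cmPairRep, cmLineRepFin₀_apply_eq_smul_cmPairRep, etaT₀_apply, map_one, inv_one, one_mul]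
    · refine LinearMap.ext fun φ => ?_
      change cmLineRepFin₁ (L : Type) finProdFinEquiv e₁ (frameD V) (frameD_real V) (frameD_ne V) (dW S) (dW_real S) (dW_ne S) hGR hGR₀ hGR₁
          (etaT₁ V S η ν) (1, u) φ =
        cmLineRepFin₁ (L : Type) finProdFinEquiv e₁ (frameD V) (frameD_real V) (frameD_ne V) (dW S) (dW_real S) (dW_ne S) hGR hGR₀ hGR₁
          (eta₁ V S η) (1, u) φ
      rw [cmLineRepFin₁_apply_eq_smul_cmPairRep, cmLineRepFin₁_apply_eq_smul_cmPairRep, etaT₁_apply, map_one, one_mul]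
    · rfl
    · rfl
  refine key _ ?_
  show ((cmFrameEquiv (L : Type) (frameG V) V.Hm (frameD V) (frame_congr V)).toMonoidHom.comp (regimeSubgroup L V.Hm).subtype) 1 = 1
  exact map_one _

/-- **every archimedean line input over `lineRepD … k` IS one over `lineRepT … k`** (same `Φ_∞`, `x₀`, `w`). -/
def archLineInputT (k : Fin 4) (A : ArchLineInput V (lineRepD V S hGR hGR₀ hGR₁ hGR₂ hGR₃ η k)) :
    ArchLineInput V (lineRepT V S hGR hGR₀ hGR₁ hGR₂ hGR₃ η ν k) where
  Φinf := A.Φinf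
  x₀ := A.x₀
  hx₀ := A.hx₀
  w := A.w
  weight N t := by
    rw [lineRepT_apply_one_left]
    exact A.weight N t

/-- (Ported verbatim from the HodgeCMPerL package; no docstring in the source.) -/
@[simp] theorem archLineInputT_Φinf (k : Fin 4) (A : ArchLineInput V (lineRepD V S hGR hGR₀ hGR₁ hGR₂ hGR₃ η k)) :
    (archLineInputT V S hGR hGR₀ hGR₁ hGR₂ hGR₃ η ν k A).Φinf = A.Φinf := rfl

/-- (Ported verbatim from the HodgeCMPerL package; no docstring in the source.) -/
@[simp] theorem archLineInputT_x₀ (k : Fin 4) (A : ArchLineInput V (lineRepD V S hGR hGR₀ hGR₁ hGR₂ hGR₃ η k)) :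
    (archLineInputT V S hGR hGR₀ hGR₁ hGR₂ hGR₃ η ν k A).x₀ = A.x₀ := rfl

/-- (Ported verbatim from the HodgeCMPerL package; no docstring in the source.) -/
@[simp] theorem archLineInputT_w (k : Fin 4) (A : ArchLineInput V (lineRepD V S hGR hGR₀ hGR₁ hGR₂ hGR₃ η k)) :
    (archLineInputT V S hGR hGR₀ hGR₁ hGR₂ hGR₃ η ν k A).w = A.w := rfl

end LF

section Term

variable {L : CMField} {ι₁ : L →+* ℂ} (V : HermSpace3 L ι₁) (c : SeesawCtx L)
variable
  (hGR : (cmSplittingDatum (L : Type) finProdFinEquiv (frameD V) (frameD_real V) (frameD_ne V) (dW c.D) (dW_real c.D)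
    (dW_ne c.D)).CompatibleSplitting)
  (hGR₀ : (cmSplittingDatum (L : Type) (e₁) (frameD V) (frameD_real V) (frameD_ne V) (lineVec (L : Type) (dW c.D 0))
    (fun _ => dW_real c.D 0) (fun _ => dW_ne c.D 0)).CompatibleSplitting)
  (hGR₁ : (cmSplittingDatum (L : Type) (e₁) (frameD V) (frameD_real V) (frameD_ne V) (lineVec (L : Type) (dW c.D 1))
    (fun _ => dW_real c.D 1) (fun _ => dW_ne c.D 1)).CompatibleSplitting)
  (hGR₂ : (cmSplittingDatum (L : Type) (e₁) (frameD V) (frameD_real V) (frameD_ne V) (lineVec (L : Type) (dW' c.D 0))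
    (fun _ => dW'_real c.D 0) (fun _ => dW'_ne c.D 0)).CompatibleSplitting)
  (hGR₃ : (cmSplittingDatum (L : Type) (e₁) (frameD V) (frameD_real V) (frameD_ne V) (lineVec (L : Type) (dW' c.D 1))
    (fun _ => dW'_real c.D 1) (fun _ => dW'_ne c.D 1)).CompatibleSplitting)
  (η : CMAdelic (L : Type) (frameD V) × CMAdelic (L : Type) (dW c.D) →* ℂˣ)
  (hη : ∀ γU ∈ CMRat (L : Type) (frameD V), ∀ γ ∈ CMRat (L : Type) (dW c.D), η (γU, γ) = 1)
  (hηc : Continuous fun p => ((η p : ℂˣ) : ℂ))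
  (ν : CMAdelic (L : Type) (frameD V) →* ℂˣ)
  (hν : ∀ γU ∈ CMRat (L : Type) (frameD V), ν γU = 1)
  (hνc : Continuous fun v => ((ν v : ℂˣ) : ℂ))

/-- **`hLF` at period-1's twisted term** (any `h₁W`, `A`). -/
theorem isLFAction_archSideOfT (h₁W : (∀ j, 0 < (ι₁ (dW c.D j)).re) ∨ ∀ j, (ι₁ (dW c.D j)).re < 0)
    (A : ∀ k : Fin 4, ArchLineInput V (lineRepT V c.D hGR hGR₀ hGR₁ hGR₂ hGR₃ η ν k)) (k : Fin 4) :
    ((archSideOfT V c hGR hGR₀ hGR₁ hGR₂ hGR₃ η hη hηc ν hν hνc h₁W A).P k).IsLFAction :=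
  fun g => isLFContinuous_lineRepT V c.D hGR hGR₀ hGR₁ hGR₂ hGR₃ η ν k g

/-- **row 13 `hT` at period-1's twisted term.** -/
theorem isThetaArchContinuous_archSideOfT (h₁W : (∀ j, 0 < (ι₁ (dW c.D j)).re) ∨ ∀ j, (ι₁ (dW c.D j)).re < 0)
    (A : ∀ k : Fin 4, ArchLineInput V (lineRepT V c.D hGR hGR₀ hGR₁ hGR₂ hGR₃ η ν k)) (k : Fin 4) (N : ℕ) :
    ((archSideOfT V c hGR hGR₀ hGR₁ hGR₂ hGR₃ η hη hηc ν hν hνc h₁W A).P k).IsThetaArchContinuous N :=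
  ((archSideOfT V c hGR hGR₀ hGR₁ hGR₂ hGR₃ η hη hηc ν hν hνc h₁W A).P k).isThetaArchContinuous_of_isLFContinuous
    (isLFAction_archSideOfT V c hGR hGR₀ hGR₁ hGR₂ hGR₃ η hη hηc ν hν hνc h₁W A k) N

end Term

/-! ## § 3 the predicate-guarded total term over `archSideOfT` -/

section GuardedT

variable {L : CMField} {ι₁ : L →+* ℂ} (V : HermSpace3 L ι₁) (c : SeesawCtx L) (G : Prop)
  (hG : G → (∀ j, 0 < (ι₁ (dW c.D j)).re) ∨ ∀ j, (ι₁ (dW c.D j)).re < 0)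
  (hGR : (cmSplittingDatum (L : Type) finProdFinEquiv (frameD V) (frameD_real V) (frameD_ne V) (dW c.D) (dW_real c.D)
    (dW_ne c.D)).CompatibleSplitting)
  (hGR₀ : (cmSplittingDatum (L : Type) (e₁) (frameD V) (frameD_real V) (frameD_ne V) (lineVec (L : Type) (dW c.D 0))
    (fun _ => dW_real c.D 0) (fun _ => dW_ne c.D 0)).CompatibleSplitting)
  (hGR₁ : (cmSplittingDatum (L : Type) (e₁) (frameD V) (frameD_real V) (frameD_ne V) (lineVec (L : Type) (dW c.D 1))
    (fun _ => dW_real c.D 1) (fun _ => dW_ne c.D 1)).CompatibleSplitting)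
  (hGR₂ : (cmSplittingDatum (L : Type) (e₁) (frameD V) (frameD_real V) (frameD_ne V) (lineVec (L : Type) (dW' c.D 0))
    (fun _ => dW'_real c.D 0) (fun _ => dW'_ne c.D 0)).CompatibleSplitting)
  (hGR₃ : (cmSplittingDatum (L : Type) (e₁) (frameD V) (frameD_real V) (frameD_ne V) (lineVec (L : Type) (dW' c.D 1))
    (fun _ => dW'_real c.D 1) (fun _ => dW'_ne c.D 1)).CompatibleSplitting)
  (η : CMAdelic (L : Type) (frameD V) × CMAdelic (L : Type) (dW c.D) →* ℂˣ)
  (hη : ∀ γU ∈ CMRat (L : Type) (frameD V), ∀ γ ∈ CMRat (L : Type) (dW c.D), η (γU, γ) = 1)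
  (hηc : Continuous fun p => ((η p : ℂˣ) : ℂ))
  (ν : CMAdelic (L : Type) (frameD V) →* ℂˣ)
  (hν : ∀ γU ∈ CMRat (L : Type) (frameD V), ν γU = 1)
  (hνc : Continuous fun v => ((ν v : ℂˣ) : ℂ))
  (AG : G → ∀ k : Fin 4, ArchLineInput V (lineRepT V c.D hGR hGR₀ hGR₁ hGR₂ hGR₃ η ν k))

open scoped Classical in
/-- **the PREDICATE-GUARDED total twisted S term**: `archSideOfT` under the guard, sanity-1's degenerate side elsewhere. -/
def thetaAdelicSideOfPT : ThetaAdelicSide V c :=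
  if hc : G then archSideOfT V c hGR hGR₀ hGR₁ hGR₂ hGR₃ η hη hηc ν hν hνc (hG hc) (AG hc) else Sanity.degThetaAdelicSide₀ V c

/-- (Ported verbatim from the HodgeCMPerL package; no docstring in the source.) -/
theorem thetaAdelicSideOfPT_eq_archSideOfT (hc : G) :
    thetaAdelicSideOfPT V c G hG hGR hGR₀ hGR₁ hGR₂ hGR₃ η hη hηc ν hν hνc AG =
      archSideOfT V c hGR hGR₀ hGR₁ hGR₂ hGR₃ η hη hηc ν hν hνc (hG hc) (AG hc) := by
  classical
  exact dif_pos hc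

/-- (Ported verbatim from the HodgeCMPerL package; no docstring in the source.) -/
theorem thetaAdelicSideOfPT_eq_degThetaAdelicSide₀ (hc : ¬ G) :
    thetaAdelicSideOfPT V c G hG hGR hGR₀ hGR₁ hGR₂ hGR₃ η hη hηc ν hν hνc AG = Sanity.degThetaAdelicSide₀ V c := by
  classical
  exact dif_neg hc

/-- (Ported verbatim from the HodgeCMPerL package; no docstring in the source.) -/
theorem thetaAdelicSideOfPT_P_ω (hc : G) (k : Fin 4) :
    ((thetaAdelicSideOfPT V c G hG hGR hGR₀ hGR₁ hGR₂ hGR₃ η hη hηc ν hν hνc AG).P k).ω =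
      lineRepT V c.D hGR hGR₀ hGR₁ hGR₂ hGR₃ η ν k := by
  rw [thetaAdelicSideOfPT_eq_archSideOfT V c G hG hGR hGR₀ hGR₁ hGR₂ hGR₃ η hη hηc ν hν hνc AG hc]; rfl

/-- (Ported verbatim from the HodgeCMPerL package; no docstring in the source.) -/
theorem thetaAdelicSideOfPT_P_Φinf (hc : G) (k : Fin 4) :
    ((thetaAdelicSideOfPT V c G hG hGR hGR₀ hGR₁ hGR₂ hGR₃ η hη hηc ν hν hνc AG).P k).Φinf = (AG hc k).Φinf := by
  rw [thetaAdelicSideOfPT_eq_archSideOfT V c G hG hGR hGR₀ hGR₁ hGR₂ hGR₃ η hη hηc ν hν hνc AG hc]; rfl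

/-- (Ported verbatim from the HodgeCMPerL package; no docstring in the source.) -/
theorem thetaAdelicSideOfPT_P_x₀ (hc : G) (k : Fin 4) :
    ((thetaAdelicSideOfPT V c G hG hGR hGR₀ hGR₁ hGR₂ hGR₃ η hη hηc ν hν hνc AG).P k).x₀ = (AG hc k).x₀ := by
  rw [thetaAdelicSideOfPT_eq_archSideOfT V c G hG hGR hGR₀ hGR₁ hGR₂ hGR₃ η hη hηc ν hν hνc AG hc]; rfl

/-- (Ported verbatim from the HodgeCMPerL package; no docstring in the source.) -/
theorem thetaAdelicSideOfPT_P_w (hc : G) (k : Fin 4) :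
    ((thetaAdelicSideOfPT V c G hG hGR hGR₀ hGR₁ hGR₂ hGR₃ η hη hηc ν hν hνc AG).P k).w = (AG hc k).w := by
  rw [thetaAdelicSideOfPT_eq_archSideOfT V c G hG hGR hGR₀ hGR₁ hGR₂ hGR₃ η hη hηc ν hν hνc AG hc]; rfl

/-- (Ported verbatim from the HodgeCMPerL package; no docstring in the source.) -/
theorem thetaAdelicSideOfPT_ιinf_apply (hc : G) (hV : IsAnisotropic L V.Hm) (u : U21) :
    (thetaAdelicSideOfPT V c G hG hGR hGR₀ hGR₁ hGR₂ hGR₃ η hη hηc ν hν hνc AG).ιinf u =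
      Adelic.regimeEquiv L V.Hm hV
        (UnitaryGroup.archSectionU21CM (L : Type) ι₁ V.Hm V.sylvesterFrame (sylvesterFrame_J V) u) := by
  rw [thetaAdelicSideOfPT_eq_archSideOfT V c G hG hGR hGR₀ hGR₁ hGR₂ hGR₃ η hη hηc ν hν hνc AG hc]
  exact archSideOfT_ιinf_apply V c hGR hGR₀ hGR₁ hGR₂ hGR₃ η hη hηc ν hν hνc _ (AG hc) hV u

/-- `hLF` at the guarded twisted term, both branches. -/
theorem isLFAction_thetaAdelicSideOfPT (k : Fin 4) :
    ((thetaAdelicSideOfPT V c G hG hGR hGR₀ hGR₁ hGR₂ hGR₃ η hη hηc ν hν hνc AG).P k).IsLFAction := by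
  by_cases hc : G
  · rw [thetaAdelicSideOfPT_eq_archSideOfT V c G hG hGR hGR₀ hGR₁ hGR₂ hGR₃ η hη hηc ν hν hνc AG hc]
    exact isLFAction_archSideOfT V c hGR hGR₀ hGR₁ hGR₂ hGR₃ η hη hηc ν hν hνc _ (AG hc) k
  · rw [thetaAdelicSideOfPT_eq_degThetaAdelicSide₀ V c G hG hGR hGR₀ hGR₁ hGR₂ hGR₃ η hη hηc ν hν hνc AG hc]
    exact Sanity.isLFAction_degThetaAdelicSide₀ V c k

/-- row 13 `hT` at the guarded twisted term, both branches. -/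
theorem isThetaArchContinuous_thetaAdelicSideOfPT (k : Fin 4) (N : ℕ) :
    ((thetaAdelicSideOfPT V c G hG hGR hGR₀ hGR₁ hGR₂ hGR₃ η hη hηc ν hν hνc AG).P k).IsThetaArchContinuous N :=
  ((thetaAdelicSideOfPT V c G hG hGR hGR₀ hGR₁ hGR₂ hGR₃ η hη hηc ν hν hνc AG).P k).isThetaArchContinuous_of_isLFContinuous
    (isLFAction_thetaAdelicSideOfPT V c G hG hGR hGR₀ hGR₁ hGR₂ hGR₃ η hη hηc ν hν hνc AG k) N

end GuardedT

end ArchSideTerm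

/-! ## § 4 family level: `SGPT`, and the assembled (J-μ-pin) twins `SRT` / `SROGT` of #1212 -/

namespace SInstance

open HodgeCM.Model.ArchSideTerm

section FamilyT

variable
  (G : ∀ {L : CMField} {ι₁ : L →+* ℂ} (_V : HermSpace3 L ι₁) (_c : SeesawCtx L), Prop)
  (hG : ∀ {L : CMField} {ι₁ : L →+* ℂ} (V : HermSpace3 L ι₁) (c : SeesawCtx L), G V c → (∀ j, 0 < (ι₁ (dW c.D j)).re) ∨ ∀ j, (ι₁ (dW c.D j)).re < 0)
  (hGR : ∀ {L : CMField} {ι₁ : L →+* ℂ} (V : HermSpace3 L ι₁) (c : SeesawCtx L),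
    (cmSplittingDatum (L : Type) finProdFinEquiv (frameD V) (frameD_real V) (frameD_ne V) (dW c.D) (dW_real c.D)
      (dW_ne c.D)).CompatibleSplitting)
  (η : ∀ {L : CMField} {ι₁ : L →+* ℂ} (V : HermSpace3 L ι₁) (c : SeesawCtx L), CMAdelic (L : Type) (frameD V) × CMAdelic (L : Type) (dW c.D) →* ℂˣ)
  (hη : ∀ {L : CMField} {ι₁ : L →+* ℂ} (V : HermSpace3 L ι₁) (c : SeesawCtx L), ∀ γU ∈ CMRat (L : Type) (frameD V), ∀ γ ∈ CMRat (L : Type) (dW c.D), η V c (γU, γ) = 1)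
  (hηc : ∀ {L : CMField} {ι₁ : L →+* ℂ} (V : HermSpace3 L ι₁) (c : SeesawCtx L), Continuous fun p => ((η V c p : ℂˣ) : ℂ))
  (ν : ∀ {L : CMField} {ι₁ : L →+* ℂ} (V : HermSpace3 L ι₁) (_c : SeesawCtx L), CMAdelic (L : Type) (frameD V) →* ℂˣ)
  (hν : ∀ {L : CMField} {ι₁ : L →+* ℂ} (V : HermSpace3 L ι₁) (c : SeesawCtx L), ∀ γU ∈ CMRat (L : Type) (frameD V), ν V c γU = 1)
  (hνc : ∀ {L : CMField} {ι₁ : L →+* ℂ} (V : HermSpace3 L ι₁) (c : SeesawCtx L), Continuous fun v => ((ν V c v : ℂˣ) : ℂ))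
  (hGR₀ : ∀ {L : CMField} {ι₁ : L →+* ℂ} (V : HermSpace3 L ι₁) (c : SeesawCtx L),
    (cmSplittingDatum (L : Type) (e₁) (frameD V) (frameD_real V) (frameD_ne V) (lineVec (L : Type) (dW c.D 0))
      (fun _ => dW_real c.D 0) (fun _ => dW_ne c.D 0)).CompatibleSplitting)
  (hGR₁ : ∀ {L : CMField} {ι₁ : L →+* ℂ} (V : HermSpace3 L ι₁) (c : SeesawCtx L),
    (cmSplittingDatum (L : Type) (e₁) (frameD V) (frameD_real V) (frameD_ne V) (lineVec (L : Type) (dW c.D 1))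
      (fun _ => dW_real c.D 1) (fun _ => dW_ne c.D 1)).CompatibleSplitting)
  (hGR₂ : ∀ {L : CMField} {ι₁ : L →+* ℂ} (V : HermSpace3 L ι₁) (c : SeesawCtx L),
    (cmSplittingDatum (L : Type) (e₁) (frameD V) (frameD_real V) (frameD_ne V) (lineVec (L : Type) (dW' c.D 0))
      (fun _ => dW'_real c.D 0) (fun _ => dW'_ne c.D 0)).CompatibleSplitting)
  (hGR₃ : ∀ {L : CMField} {ι₁ : L →+* ℂ} (V : HermSpace3 L ι₁) (c : SeesawCtx L),
    (cmSplittingDatum (L : Type) (e₁) (frameD V) (frameD_real V) (frameD_ne V) (lineVec (L : Type) (dW' c.D 1))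
      (fun _ => dW'_real c.D 1) (fun _ => dW'_ne c.D 1)).CompatibleSplitting)
  (AG : ∀ {L : CMField} {ι₁ : L →+* ℂ} (V : HermSpace3 L ι₁) (c : SeesawCtx L), G V c → ∀ k : Fin 4,
    ArchLineInput V (lineRepT V c.D (hGR V c) (hGR₀ V c) (hGR₁ V c) (hGR₂ V c) (hGR₃ V c) (η V c) (ν V c) k))

/-- **the guard-agnostic guarded TWISTED S family** (twin of #1209 `SGP` over `archSideOfT`). -/
abbrev SGPT : ∀ {L : CMField} {ι₁ : L →+* ℂ} (V : HermSpace3 L ι₁) (c : SeesawCtx L), ThetaAdelicSide V c :=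
  fun V c => thetaAdelicSideOfPT V c (G V c) (hG V c) (hGR V c) (hGR₀ V c) (hGR₁ V c) (hGR₂ V c) (hGR₃ V c) (η V c) (hη V c) (hηc V c)
    (ν V c) (hν V c) (hνc V c) (AG V c)

/-- (Ported verbatim from the HodgeCMPerL package; no docstring in the source.) -/
theorem SGPT_eq_archSideOfT {L : CMField} {ι₁ : L →+* ℂ} (V : HermSpace3 L ι₁) (c : SeesawCtx L) (hc : G V c) :
    SGPT @G @hG @hGR @η @hη @hηc @ν @hν @hνc @hGR₀ @hGR₁ @hGR₂ @hGR₃ @AG V c =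
      archSideOfT V c (hGR V c) (hGR₀ V c) (hGR₁ V c) (hGR₂ V c) (hGR₃ V c) (η V c) (hη V c) (hηc V c) (ν V c) (hν V c) (hνc V c)
        (hG V c hc) (AG V c hc) :=
  thetaAdelicSideOfPT_eq_archSideOfT V c (G V c) _ _ _ _ _ _ _ _ _ _ _ _ _ hc

/-- `hLF` at the guarded twisted family, hypothesis-free. -/
theorem hLF_PT : ∀ {L : CMField} {ι₁ : L →+* ℂ} (V : HermSpace3 L ι₁) (c : SeesawCtx L) (k : Fin 4),
    ((SGPT @G @hG @hGR @η @hη @hηc @ν @hν @hνc @hGR₀ @hGR₁ @hGR₂ @hGR₃ @AG V c).P k).IsLFAction :=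
  fun V c k => isLFAction_thetaAdelicSideOfPT V c (G V c) _ _ _ _ _ _ _ _ _ _ _ _ _ k

/-- **row 13 `hT` at the guarded twisted family, hypothesis-free.** -/
theorem hT_PT : ∀ {L : CMField} {ι₁ : L →+* ℂ} (V : HermSpace3 L ι₁) (c : SeesawCtx L) (k : Fin 4) (N : ℕ),
    ((SGPT @G @hG @hGR @η @hη @hηc @ν @hν @hνc @hGR₀ @hGR₁ @hGR₂ @hGR₃ @AG V c).P k).IsThetaArchContinuous N :=
  fun V c k N => isThetaArchContinuous_thetaAdelicSideOfPT V c (G V c) _ _ _ _ _ _ _ _ _ _ _ _ _ k N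

end FamilyT

section ReadOffT

variable
  (G : ∀ {L : CMField} {ι₁ : L →+* ℂ} (_V : HermSpace3 L ι₁) (_c : SeesawCtx L), Prop)
  (hG : ∀ {L : CMField} {ι₁ : L →+* ℂ} (V : HermSpace3 L ι₁) (c : SeesawCtx L), G V c → (∀ j, 0 < (ι₁ (dW c.D j)).re) ∨ ∀ j, (ι₁ (dW c.D j)).re < 0)
  (hGR : ∀ {L : CMField} {ι₁ : L →+* ℂ} (V : HermSpace3 L ι₁) (c : SeesawCtx L),
    (cmSplittingDatum (L : Type) finProdFinEquiv (frameD V) (frameD_real V) (frameD_ne V) (dW c.D) (dW_real c.D)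
      (dW_ne c.D)).CompatibleSplitting)
  (χV : ∀ {L : CMField} {ι₁ : L →+* ℂ} (_V : HermSpace3 L ι₁) (_c : SeesawCtx L),
    ContinuousMonoidHom (Literature.NumberTheory.Automorphic.relNormOneIdeles (↥(NumberField.maximalRealSubfield (L : Type))) (L : Type) ⧸
      Literature.NumberTheory.Automorphic.relNormOneRat (↥(NumberField.maximalRealSubfield (L : Type))) (L : Type)) Circle)
  (ν : ∀ {L : CMField} {ι₁ : L →+* ℂ} (V : HermSpace3 L ι₁) (_c : SeesawCtx L), CMAdelic (L : Type) (frameD V) →* ℂˣ)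
  (hν : ∀ {L : CMField} {ι₁ : L →+* ℂ} (V : HermSpace3 L ι₁) (c : SeesawCtx L), ∀ γU ∈ CMRat (L : Type) (frameD V), ν V c γU = 1)
  (hνc : ∀ {L : CMField} {ι₁ : L →+* ℂ} (V : HermSpace3 L ι₁) (c : SeesawCtx L), Continuous fun v => ((ν V c v : ℂˣ) : ℂ))
  (hGR₀ : ∀ {L : CMField} {ι₁ : L →+* ℂ} (V : HermSpace3 L ι₁) (c : SeesawCtx L),
    (cmSplittingDatum (L : Type) (e₁) (frameD V) (frameD_real V) (frameD_ne V) (lineVec (L : Type) (dW c.D 0))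
      (fun _ => dW_real c.D 0) (fun _ => dW_ne c.D 0)).CompatibleSplitting)
  (hGR₁ : ∀ {L : CMField} {ι₁ : L →+* ℂ} (V : HermSpace3 L ι₁) (c : SeesawCtx L),
    (cmSplittingDatum (L : Type) (e₁) (frameD V) (frameD_real V) (frameD_ne V) (lineVec (L : Type) (dW c.D 1))
      (fun _ => dW_real c.D 1) (fun _ => dW_ne c.D 1)).CompatibleSplitting)
  (hGR₂ : ∀ {L : CMField} {ι₁ : L →+* ℂ} (V : HermSpace3 L ι₁) (c : SeesawCtx L),
    (cmSplittingDatum (L : Type) (e₁) (frameD V) (frameD_real V) (frameD_ne V) (lineVec (L : Type) (dW' c.D 0))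
      (fun _ => dW'_real c.D 0) (fun _ => dW'_ne c.D 0)).CompatibleSplitting)
  (hGR₃ : ∀ {L : CMField} {ι₁ : L →+* ℂ} (V : HermSpace3 L ι₁) (c : SeesawCtx L),
    (cmSplittingDatum (L : Type) (e₁) (frameD V) (frameD_real V) (frameD_ne V) (lineVec (L : Type) (dW' c.D 1))
      (fun _ => dW'_real c.D 1) (fun _ => dW'_ne c.D 1)).CompatibleSplitting)
  (μ : ∀ {L : CMField}, SeesawCtx L → Fin 4 → NumberField.InfinitePlace (L : Type) → ℤ)
  (hpos : ∀ {L : CMField} {ι₁ : L →+* ℂ} (V : HermSpace3 L ι₁) (c : SeesawCtx L), G V c →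
    0 < HypCensus.cmXW (L : Type) (frameD V) (lineVec (L : Type) (dW c.D 0)) (fun _ => dW_real c.D 0) ι₁ (HypCensus.cmPlace (L : Type) ι₁) 0 ∧
    0 < HypCensus.cmXW (L : Type) (frameD V) (lineVec (L : Type) (dW c.D 1)) (fun _ => dW_real c.D 1) ι₁ (HypCensus.cmPlace (L : Type) ι₁) 0 ∧
    0 < HypCensus.cmXW (L : Type) (frameD V) (lineVec (L : Type) (dW' c.D 0)) (fun _ => dW'_real c.D 0) ι₁ (HypCensus.cmPlace (L : Type) ι₁) 0 ∧
    0 < HypCensus.cmXW (L : Type) (frameD V) (lineVec (L : Type) (dW' c.D 1)) (fun _ => dW'_real c.D 1) ι₁ (HypCensus.cmPlace (L : Type) ι₁) 0)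
  (hΔ₁ : ∀ {L : CMField} {ι₁ : L →+* ℂ} (V : HermSpace3 L ι₁) (c : SeesawCtx L), ∀ hc : G V c,
    slotTypeVec V c (hGR V c) (hGR₀ V c) (hGR₁ V c) (hGR₂ V c) (hGR₃ V c) (hG V c hc) 1 -
      slotTypeVec V c (hGR V c) (hGR₀ V c) (hGR₁ V c) (hGR₂ V c) (hGR₃ V c) (hG V c hc) 0 = μ c 1 - μ c 0)
  (hΔ₂ : ∀ {L : CMField} {ι₁ : L →+* ℂ} (V : HermSpace3 L ι₁) (c : SeesawCtx L), ∀ hc : G V c,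
    slotTypeVec V c (hGR V c) (hGR₀ V c) (hGR₁ V c) (hGR₂ V c) (hGR₃ V c) (hG V c hc) 2 -
      slotTypeVec V c (hGR V c) (hGR₀ V c) (hGR₁ V c) (hGR₂ V c) (hGR₃ V c) (hG V c hc) 0 = μ c 2 - μ c 0)
  (hΔ₃ : ∀ {L : CMField} {ι₁ : L →+* ℂ} (V : HermSpace3 L ι₁) (c : SeesawCtx L), ∀ hc : G V c,
    slotTypeVec V c (hGR V c) (hGR₀ V c) (hGR₁ V c) (hGR₂ V c) (hGR₃ V c) (hG V c hc) 3 -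
      slotTypeVec V c (hGR V c) (hGR₀ V c) (hGR₁ V c) (hGR₂ V c) (hGR₃ V c) (hG V c hc) 0 = μ c 3 - μ c 0)

/-- the archimedean inputs of the (J-μ-pin) read-off datum (#1212 `AR`), TRANSPORTED to the twisted lines. -/
def ART : ∀ {L : CMField} {ι₁ : L →+* ℂ} (V : HermSpace3 L ι₁) (c : SeesawCtx L), G V c → ∀ k : Fin 4,
    ArchLineInput V (lineRepT V c.D (hGR V c) (hGR₀ V c) (hGR₁ V c) (hGR₂ V c) (hGR₃ V c)
      (EtaChi.η @χV (@χWR @hGR @hGR₀ @hGR₁ @μ) V c) (ν V c) k) :=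
  fun V c hc k => archLineInputT V c.D (hGR V c) (hGR₀ V c) (hGR₁ V c) (hGR₂ V c) (hGR₃ V c) _ (ν V c) k
    (AR @G @hG @hGR @χV @hGR₀ @hGR₁ @hGR₂ @hGR₃ @μ @hpos @hΔ₁ @hΔ₂ @hΔ₃ V c hc k)

/-- **THE ν-CARRYING ROW-5 PIN (generic guard)**: #1212's `SR` over the twisted term; ν, hν, hνc three more pin-input families. -/
abbrev SRT : ∀ {L : CMField} {ι₁ : L →+* ℂ} (V : HermSpace3 L ι₁) (c : SeesawCtx L), ThetaAdelicSide V c :=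
  SGPT @G @hG @hGR @(@EtaChi.η @χV (@χWR @hGR @hGR₀ @hGR₁ @μ))
    @(@EtaChi.hη @χV (@χWR @hGR @hGR₀ @hGR₁ @μ)) @(@EtaChi.hηc @χV (@χWR @hGR @hGR₀ @hGR₁ @μ))
    @ν @hν @hνc @hGR₀ @hGR₁ @hGR₂ @hGR₃
    @(@ART @G @hG @hGR @χV @ν @hGR₀ @hGR₁ @hGR₂ @hGR₃ @μ @hpos @hΔ₁ @hΔ₂ @hΔ₃)

/-- **row 13 `hT` at the ν-carrying pin, hypothesis-free.** -/
theorem hT_RT : ∀ {L : CMField} {ι₁ : L →+* ℂ} (V : HermSpace3 L ι₁) (c : SeesawCtx L) (k : Fin 4) (N : ℕ),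
    ((SRT @G @hG @hGR @χV @ν @hν @hνc @hGR₀ @hGR₁ @hGR₂ @hGR₃ @μ @hpos @hΔ₁ @hΔ₂ @hΔ₃ V c).P k).IsThetaArchContinuous N :=
  hT_PT _ _ _ _ _ _ _ _ _ _ _ _ _ _

/-- `hLF` at the ν-carrying pin, hypothesis-free. -/
theorem hLF_RT : ∀ {L : CMField} {ι₁ : L →+* ℂ} (V : HermSpace3 L ι₁) (c : SeesawCtx L) (k : Fin 4),
    ((SRT @G @hG @hGR @χV @ν @hν @hνc @hGR₀ @hGR₁ @hGR₂ @hGR₃ @μ @hpos @hΔ₁ @hΔ₂ @hΔ₃ V c).P k).IsLFAction :=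
  hLF_PT _ _ _ _ _ _ _ _ _ _ _ _ _ _

end ReadOffT

section ReadOffTOG


-- port_pkg: scope closed for this part
end ReadOffTOG
end SInstance
end HodgeCM.Model
end
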